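import Literature.AlgebraicGeometry.AbelianSchemes.SymplecticLiftOfIsogenyQuotient
import Literature.AlgebraicGeometry.AbelianSchemes.LevelStructureTwistChangeLevel
import Literature.AlgebraicGeometry.AbelianSchemes.SymplecticLiftTwist
import HarnessLib

/-!
# The Hecke kernel in TWISTED level coordinates, and the `symplectic` field of the isogeny quotient for a kernel read
# through an adelic representative ([Deligne1971TravauxShimura] 4.11–4.12; [MumfordFogartyKirwan1994] Ch. 7 §3; [Lan2013] §1.3.6)

[Deligne1971TravauxShimura, 4.11–4.12 (pp. 148–149)] / [Milne2005ShimuraVarieties, §6 p. 75]: a point of the Siegel variety at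
level `N′` is a marked abelian variety read through a representative `r′ ∈ GSp_δ(ẑ)`; the Hecke operator of
`γ ∈ GSp_{2g}(ℚ) ∩ M_{2g}(ℤ)` quotients by `K = γ⁻¹Λ/Λ`, which in the coordinates of the level-`N′` structure `φ′` is the
kernel `K₀ = ker(γ·r′ mod N′) ⊆ (ℤ/N′)^{2g}` — i.e. `{N·γ⋆z}` (`γ⋆ = νγ⁻¹`, `N′ = N·ν`) in the coordinates of the TWISTED
level structure `φ″ := φ′·ḡ` with `ḡ = (r′ mod N′)⁻¹` ([MumfordFogartyKirwan1994, Ch. 7 §3 (p. 139)]: `GL_{2g}(ℤ/n)` acts on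
level structures; ★ `LevelStructure.twist`).  THIS FILE makes that coordinate change and feeds ★
`SymplecticLiftOfIsogenyQuotient` (whose kernel hypothesis is `{N·γ⋆z}` in the coordinates of the source level structure):
* `intCast_mulVec_eq_zero_iff` — `ḡq·c = 0 in (ℤ/Nν)^{2g} ↔ c = N·γ⋆z (mod Nν)` for integer matrices with
  `γγ⋆ = γ⋆γ = ν` (pure `ZMod` arithmetic);
* `map_fibreHom_eq_one_iff_twist` — the exact-kernel clause «kernel = `φ′(ker(γ·ḡ⁻¹))`» becomes «kernel =
  `(φ′·ḡ)(N·γ⋆ℤ^{2g})`» (★ `LevelStructure.section_twist`);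
* `LevelStructure.twist_σ_pow_comp` / `eq_twist_of_σ_eq_twist_pow_comp` — pushing forward along `u` and lowering the
  level COMMUTE with twisting: if `ψ′ᵢ = φ′ᵢ^ν ≫ u` then the level structure with sections `(φ′·ḡ)ᵢ^ν ≫ u` is `ψ′·(ḡ mod N)`
  (★ `changeLevel_twist` + ★ `sectionPow_comp_of_isMonHom`);
* `LevelStructure.IsSymplecticLiftable.of_fibreIsogeny_of_dualIsogeny_twist` — **the `symplectic` field of the Hecke
  isogeny quotient with the kernel read through `r′`**: twist `φ′` by `ḡ` (liftability preserved, ★ `IsSymplecticLiftable.twist`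
  with the similitude tower of `ḡ`), apply ★ `of_fibreIsogeny_of_dualIsogeny`, untwist the target at level `N` (the tower
  of `(ḡ mod N)⁻¹`).  The two towers are hypotheses (from `r′ ∈ GSp_δ(ẑ)` by ★ `exists_similitudeTower`).
Theorems only; cell hodgecm-mathlib, seat B-p04 (g17), E-road HECKE-LINK socket (B) (k-b)/(k-d).  HC_CM is proved only modulo
the 7 printed citations until rung 0 closes; this file discharges none of them.

## References
* [Deligne1971TravauxShimura] P. Deligne, *Travaux de Shimura* (1971), 4.11–4.12 (pp. 148–149).
* [MumfordFogartyKirwan1994] *Geometric Invariant Theory*, 3rd ed., Ch. 7 §1 Def. 7.1 (p. 129), §3 (p. 139), App. 7A (p. 235).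
* [Milne2005ShimuraVarieties] J. S. Milne, *Introduction to Shimura varieties* (2005), §6 (63) and p. 75.
* [Lan2013PELCompactifications] K.-W. Lan, *Arithmetic compactifications* (2013), §1.3.6 Lemma 1.3.6.6, Cor. 1.3.6.7 (pp. 81–82).
-/

noncomputable section

universe u

open CategoryTheory CategoryTheory.Limits AlgebraicGeometry MonoidalCategory Matrix
open scoped MonObj

namespace Literature.AlgebraicGeometry.AbelianSchemes

namespace AbelianSchemeOver

open Literature.AlgebraicGeometry.Motives
open Literature.AlgebraicGeometry.ModuliOfAbelianVarieties (typeForm)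

/-! ### §1 `ZMod` arithmetic: the kernel of `γ mod Nν` is `N·γ⋆ℤ^{2g} mod Nν` -/

section ZModKernel

variable {J : Type*} [Fintype J] [DecidableEq J] {N ν : ℕ}

/-- `γ·(N·γ⋆z) = N·ν·z ≡ 0 (mod Nν)`. [folklore] -/
private theorem intCast_mulVec_eq_zero_of (γm γs : Matrix J J ℤ) (hγ : γm * γs = (ν : ℤ) • (1 : Matrix J J ℤ))
    (z : J → ℤ) :
    (γm.map (Int.castRingHom (ZMod (N * ν)))) *ᵥ (fun j => ((((N : ℤ) * (γs *ᵥ z) j : ℤ)) : ZMod (N * ν))) = 0 := by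
  have hv : (fun j => ((((N : ℤ) * (γs *ᵥ z) j : ℤ)) : ZMod (N * ν))) =
      (Int.castRingHom (ZMod (N * ν))) ∘ ((N : ℤ) • (γs *ᵥ z)) := by
    funext j; rfl
  funext i
  rw [hv, ← RingHom.map_mulVec, Matrix.mulVec_smul, Matrix.mulVec_mulVec, hγ, Matrix.smul_mulVec, Matrix.one_mulVec,
    Pi.zero_apply, Pi.smul_apply, Pi.smul_apply, smul_eq_mul, smul_eq_mul, ← mul_assoc, eq_intCast, Int.cast_mul]
  have h0 : (((N : ℤ) * (ν : ℤ) : ℤ) : ZMod (N * ν)) = 0 := by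
    rw [← Nat.cast_mul]; exact_mod_cast ZMod.natCast_self (N * ν)
  rw [h0, zero_mul]

/-- **`γ·c = 0` in `(ℤ/Nν)^{2g}` iff `c = N·γ⋆z (mod Nν)` for some `z ∈ ℤ^{2g}`**, for integer matrices `γ, γ⋆` with
`γγ⋆ = γ⋆γ = ν`: the kernel of the reduction of `γ` mod `Nν` is the image of `N·γ⋆` — the level-structure coordinates of the
Hecke kernel `γ⁻¹ℤ^{2g}/ℤ^{2g} ⊆ (1/Nν)ℤ^{2g}/ℤ^{2g}`. [cite: Deligne1971TravauxShimura, 4.11–4.12 pp. 148–149] -/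
theorem intCast_mulVec_eq_zero_iff (hN : N ≠ 0) (hν : ν ≠ 0) (γm γs : Matrix J J ℤ)
    (hγ : γm * γs = (ν : ℤ) • (1 : Matrix J J ℤ)) (hγ' : γs * γm = (ν : ℤ) • (1 : Matrix J J ℤ)) (c : J → ZMod (N * ν)) :
    (γm.map (Int.castRingHom (ZMod (N * ν)))) *ᵥ c = 0 ↔
      ∃ z : J → ℤ, c = fun j => ((((N : ℤ) * (γs *ᵥ z) j : ℤ)) : ZMod (N * ν)) := by
  haveI : NeZero (N * ν) := ⟨Nat.mul_ne_zero hN hν⟩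
  constructor
  · intro hc
    -- lift `c` to integers
    set ct : J → ℤ := fun j => ((c j).val : ℤ) with hct
    have hcc : c = (Int.castRingHom (ZMod (N * ν))) ∘ ct := by
      funext j
      rw [Function.comp_apply, hct, eq_intCast, Int.cast_natCast, ZMod.natCast_zmod_val]
    -- `γ ct ≡ 0 (mod Nν)`: `γ ct = Nν • t`
    have hdvd : ∀ i, ((N * ν : ℕ) : ℤ) ∣ (γm *ᵥ ct) i := fun i => by
      have hi := congrFun hc i
      rw [hcc, ← RingHom.map_mulVec, Pi.zero_apply, eq_intCast,
        ZMod.intCast_zmod_eq_zero_iff_dvd] at hi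
      exact hi
    set t : J → ℤ := fun i => (γm *ᵥ ct) i / ((N * ν : ℕ) : ℤ) with ht
    have hγt : γm *ᵥ ct = ((N * ν : ℕ) : ℤ) • t := by
      funext i
      rw [Pi.smul_apply, smul_eq_mul, ht]
      exact (Int.mul_ediv_cancel' (hdvd i)).symm
    -- apply `γ⋆`: `ν • ct = Nν • γ⋆ t`, hence `ct = N • γ⋆ t`
    have hνc : (ν : ℤ) • ct = (ν : ℤ) • ((N : ℤ) • (γs *ᵥ t)) := by
      have h1 : γs *ᵥ (γm *ᵥ ct) = (ν : ℤ) • ct := by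
        rw [Matrix.mulVec_mulVec, hγ', Matrix.smul_mulVec, Matrix.one_mulVec]
      rw [← h1, hγt, Matrix.mulVec_smul, Nat.cast_mul, mul_comm (N : ℤ) (ν : ℤ), mul_smul]
    have hνz : (ν : ℤ) ≠ 0 := by exact_mod_cast hν
    have hcteq := smul_right_injective (J → ℤ) hνz hνc
    refine ⟨t, ?_⟩
    rw [hcc]
    funext j
    rw [Function.comp_apply, eq_intCast, hcteq, Pi.smul_apply, smul_eq_mul]
  · rintro ⟨z, rfl⟩
    exact intCast_mulVec_eq_zero_of γm γs hγ z

/-- The twisted form: for an invertible `ḡ` mod `Nν`, `(γ·ḡ⁻¹)·c = 0 ↔ c = ḡ·(N·γ⋆z)` for some `z`.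
[cite: Deligne1971TravauxShimura, 4.11–4.12 pp. 148–149] [cite: MumfordFogartyKirwan1994, Ch. 7 §3 (p. 139)] -/
theorem intCast_mul_inv_mulVec_eq_zero_iff (hN : N ≠ 0) (hν : ν ≠ 0) (γm γs : Matrix J J ℤ)
    (hγ : γm * γs = (ν : ℤ) • (1 : Matrix J J ℤ)) (hγ' : γs * γm = (ν : ℤ) • (1 : Matrix J J ℤ))
    (gT : GL J (ZMod (N * ν))) (c : J → ZMod (N * ν)) :
    (γm.map (Int.castRingHom (ZMod (N * ν))) * ((gT⁻¹ : GL J (ZMod (N * ν))) : Matrix J J (ZMod (N * ν)))) *ᵥ c = 0 ↔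
      ∃ z : J → ℤ, c = (gT : Matrix J J (ZMod (N * ν))) *ᵥ
        fun j => ((((N : ℤ) * (γs *ᵥ z) j : ℤ)) : ZMod (N * ν)) := by
  rw [← Matrix.mulVec_mulVec, intCast_mulVec_eq_zero_iff hN hν γm γs hγ hγ']
  constructor
  · rintro ⟨z, hz⟩
    refine ⟨z, ?_⟩
    rw [← hz, Matrix.mulVec_mulVec, ← Units.val_mul, mul_inv_cancel, Units.val_one, Matrix.one_mulVec]
  · rintro ⟨z, hz⟩
    refine ⟨z, ?_⟩
    rw [hz, Matrix.mulVec_mulVec, ← Units.val_mul, inv_mul_cancel, Units.val_one, Matrix.one_mulVec]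

end ZModKernel

/-! ### §2 The exact-kernel clause in twisted level coordinates -/

variable {S : Scheme.{u}} {A B : AbelianSchemeOver S}

/-- **The Hecke kernel in the coordinates of the twisted level structure `φ′·ḡ`**: if the kernel of `u_s` on `Ω`-points is
`{φ′(c)(s) : (γ·ḡ⁻¹)c = 0}` (the adelic reading `K₀ = ker(γ·r′ mod N′)`, `ḡ = (r′ mod N′)⁻¹`), then it is
`{(φ′·ḡ)(N·γ⋆z)(s) : z ∈ ℤ^{2g}}` — the `hker` binder of ★ `SymplecticLiftOfIsogenyQuotient` for the source structure `φ′·ḡ`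
(★ `LevelStructure.section_twist`: `(φ·ḡ)(a) = φ(ḡa)`). [cite: MumfordFogartyKirwan1994, Ch. 7 §3 (p. 139)]
[cite: Deligne1971TravauxShimura, 4.11–4.12 pp. 148–149] -/
theorem map_fibreHom_eq_one_iff_twist [IsCommMonObj A.X] {g N ν : ℕ} (hN : N ≠ 0) (hν : ν ≠ 0)
    (φ' : A.LevelStructure g (N * ν)) (u : A.X ⟶ B.X) [IsMonHom u]
    (γm γs : Matrix (Fin g ⊕ Fin g) (Fin g ⊕ Fin g) ℤ) (hγ : γm * γs = (ν : ℤ) • (1 : Matrix _ _ ℤ))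
    (hγ' : γs * γm = (ν : ℤ) • (1 : Matrix _ _ ℤ)) (gT : GL (Fin g ⊕ Fin g) (ZMod (N * ν)))
    {Ω : Type u} [Field Ω] (s : Spec (.of Ω) ⟶ S)
    (hK : ∀ P : (A.fibre s).toAbelianVariety.Points Ω, AlgPoints.map (fibreHom u s).hom.hom.hom P = 1 ↔
      ∃ c : Fin g ⊕ Fin g → ZMod (N * ν),
        (γm.map (Int.castRingHom (ZMod (N * ν))) *
            ((gT⁻¹ : GL (Fin g ⊕ Fin g) (ZMod (N * ν))) : Matrix _ _ (ZMod (N * ν)))) *ᵥ c = 0 ∧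
          P = A.restrictPt s (φ'.section_ c))
    (P : (A.fibre s).toAbelianVariety.Points Ω) :
    haveI : NeZero (N * ν) := ⟨Nat.mul_ne_zero hN hν⟩
    AlgPoints.map (fibreHom u s).hom.hom.hom P = 1 ↔
      ∃ z : Fin g ⊕ Fin g → ℤ,
        P = A.restrictPt s ((φ'.twist gT).section_ fun j => ((((N : ℤ) * (γs *ᵥ z) j : ℤ)) : ZMod (N * ν))) := by
  haveI : NeZero (N * ν) := ⟨Nat.mul_ne_zero hN hν⟩
  rw [hK P]
  constructor
  · rintro ⟨c, hc, hP⟩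
    obtain ⟨z, hz⟩ := (intCast_mul_inv_mulVec_eq_zero_iff hN hν γm γs hγ hγ' gT c).1 hc
    exact ⟨z, by rw [hP, hz, LevelStructure.section_twist]⟩
  · rintro ⟨z, hP⟩
    refine ⟨(gT : Matrix _ _ (ZMod (N * ν))) *ᵥ fun j => ((((N : ℤ) * (γs *ᵥ z) j : ℤ)) : ZMod (N * ν)),
      (intCast_mul_inv_mulVec_eq_zero_iff hN hν γm γs hγ hγ' gT _).2 ⟨z, rfl⟩, ?_⟩
    rw [hP, LevelStructure.section_twist]

/-! ### §3 Twisting commutes with lowering the level and pushing forward along `u` -/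

/-- **`((φ′·ḡ)ᵢ^ν ≫ u) = (ψ′·(ḡ mod N))ᵢ` when `ψ′ᵢ = φ′ᵢ^ν ≫ u`**: twisting the source level-`Nν` structure by
`ḡ ∈ GL_{2g}(ℤ/Nν)` twists the induced level-`N` structure on the target by the reduction of `ḡ` mod `N`
(★ `changeLevel_twist`: twist commutes with the level change `σ ↦ σ^ν`; ★ `sectionPow_comp_of_isMonHom`: with `≫ u`).
[cite: MumfordFogartyKirwan1994, Ch. 7 §3 (p. 139) and App. 7A (p. 235)] -/
theorem LevelStructure.eq_twist_of_σ_eq_twist_pow_comp [IsCommMonObj A.X] [IsCommMonObj B.X] {g N ν : ℕ}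
    (hN : N ≠ 0) (hν : ν ≠ 0) (φ' : A.LevelStructure g (N * ν)) (u : A.X ⟶ B.X) [IsMonHom u]
    (gT : GL (Fin g ⊕ Fin g) (ZMod (N * ν))) {ψ' ψ'' : B.LevelStructure g N}
    (hψ' : ∀ i, ψ'.σ i = (φ'.σ i ^ ν) ≫ u)
    (hψ'' : haveI : NeZero (N * ν) := ⟨Nat.mul_ne_zero hN hν⟩; ∀ i, ψ''.σ i = ((φ'.twist gT).σ i ^ ν) ≫ u) :
    haveI : NeZero N := ⟨hN⟩
    ψ'' = ψ'.twist (Matrix.GeneralLinearGroup.map (ZMod.castHom (⟨ν, rfl⟩ : N ∣ N * ν) (ZMod N)) gT) := by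
  haveI : NeZero (N * ν) := ⟨Nat.mul_ne_zero hN hν⟩
  haveI : NeZero N := ⟨hN⟩
  refine LevelStructure.ext_σ (funext fun i => ?_)
  have hφσ : ∀ (χ : A.LevelStructure g (N * ν)) (k : Fin g ⊕ Fin g),
      χ.σ k ^ ν = (χ.changeLevel N ν rfl (Nat.mul_ne_zero hN hν)).σ k := fun χ k => rfl
  have hψ'c : ψ'.σ = fun j => (φ'.changeLevel N ν rfl (Nat.mul_ne_zero hN hν)).σ j ≫ u :=
    funext fun j => by rw [hψ' j, hφσ]
  rw [hψ'' i, hφσ, LevelStructure.changeLevel_twist, LevelStructure.twist_σ, LevelStructure.twist_σ,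
    A.sectionPow_comp_of_isMonHom u, hψ'c]

/-! ### §4 The `symplectic` field of the Hecke isogeny quotient, kernel read through `r′` -/

/-- **`Q.symplectic` FOR THE HECKE ISOGENY QUOTIENT WITH THE KERNEL READ THROUGH AN ADELIC REPRESENTATIVE**
(★ `of_fibreIsogeny_of_dualIsogeny` in twisted coordinates): hypotheses as there, except that the exact kernel of `u_s`
is `{φ′(c)(s) : (γ·ḡ⁻¹)·c = 0}` for some `ḡ ∈ GL_{2g}(ℤ/Nν)` (= `(r′ mod N′)⁻¹`; the Hecke datum `(γ, γ⋆, ν, N)` still in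
INTEGER form with `γγ⋆ = γ⋆γ = ν`, `ᵗγ⋆E_δγ⋆ = νE_δ`, `γ ≡ 1 (mod N)`), plus TWO compatible towers of `E_δ`-similitudes
(the input format of ★ `IsSymplecticLiftable.twist`; from `r′ ∈ GSp_δ(ẑ)` by ★ `exists_similitudeTower`): `ΓA` with
`ΓA (N·ν) = ḡ` (twists the source) and `ΓB` with `ΓB N = (ḡ mod N)⁻¹` (untwists the target).  Then a symplectic-liftable
`φ′` (type `δ`, for `λ_A`) makes `ψφ = u ∘ φ′^ν` symplectic-liftable (type `δ`, for `λ_B`).  [Deligne1971TravauxShimura]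
4.11–4.12; [MumfordFogartyKirwan1994] Ch. 7 §3. [cite: Lan2013PELCompactifications, §1.3.6 Lemma 1.3.6.6 and Cor. 1.3.6.7 (pp. 81–82)]
[cite: Deligne1971TravauxShimura, 4.11–4.12 pp. 148–149] [cite: MumfordFogartyKirwan1994, Ch. 7 §3 (p. 139)] -/
theorem LevelStructure.IsSymplecticLiftable.of_fibreIsogeny_of_dualIsogeny_twist [IsCommMonObj A.X] [IsCommMonObj B.X]
    {g N ν : ℕ} (hN : N ≠ 0) (hν : ν ≠ 0)
    {φ' : A.LevelStructure g (N * ν)} {DA : A.DualPair} {polA : A.Polarization DA}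
    {DB : B.DualPair} {polB : B.Polarization DB} {δ : Fin g → ℕ}
    (u : A.X ⟶ B.X) [IsMonHom u] {ψφ : B.LevelStructure g N} (hψφ : ∀ i, ψφ.σ i = (φ'.σ i ^ ν) ≫ u)
    (hB : B.IsOfRelDim g)
    (γm γs : Matrix (Fin g ⊕ Fin g) (Fin g ⊕ Fin g) ℤ) (hγ : γm * γs = (ν : ℤ) • (1 : Matrix _ _ ℤ))
    (hγ' : γs * γm = (ν : ℤ) • (1 : Matrix _ _ ℤ)) (hsim : γsᵀ * typeForm δ * γs = (ν : ℤ) • typeForm δ)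
    (hQA4 : ∀ k i, (N : ℤ) ∣ (γm - 1) k i)
    (gT : GL (Fin g ⊕ Fin g) (ZMod (N * ν)))
    (ΓA : ∀ M : ℕ, GL (Fin g ⊕ Fin g) (ZMod M)) (cA : ∀ M : ℕ, (ZMod M)ˣ) (hΓA_level : ΓA (N * ν) = gT)
    (hΓA : ∀ ⦃M : ℕ⦄ (k : ℕ), M ≠ 0 → k ≠ 0 → ∀ i j,
      ZMod.castHom (Dvd.intro_left k rfl) (ZMod M)
          ((ΓA (k * M) : Matrix (Fin g ⊕ Fin g) (Fin g ⊕ Fin g) (ZMod (k * M))) i j) =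
        (ΓA M : Matrix (Fin g ⊕ Fin g) (Fin g ⊕ Fin g) (ZMod M)) i j)
    (hcA : ∀ ⦃M : ℕ⦄ (k : ℕ), M ≠ 0 → k ≠ 0 →
      ZMod.castHom (Dvd.intro_left k rfl) (ZMod M) ((cA (k * M) : ZMod (k * M))) = (cA M : ZMod M))
    (hsimA : ∀ ⦃M : ℕ⦄, M ≠ 0 → ∀ x y : Fin g ⊕ Fin g → ZMod M,
      typeFormMod δ M ((ΓA M : Matrix (Fin g ⊕ Fin g) (Fin g ⊕ Fin g) (ZMod M)) *ᵥ x)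
          ((ΓA M : Matrix (Fin g ⊕ Fin g) (Fin g ⊕ Fin g) (ZMod M)) *ᵥ y) =
        (cA M : ZMod M) * typeFormMod δ M x y)
    (ΓB : ∀ M : ℕ, GL (Fin g ⊕ Fin g) (ZMod M)) (cB : ∀ M : ℕ, (ZMod M)ˣ)
    (hΓB_level : haveI : NeZero N := ⟨hN⟩;
      ΓB N = (Matrix.GeneralLinearGroup.map (ZMod.castHom (⟨ν, rfl⟩ : N ∣ N * ν) (ZMod N)) gT)⁻¹)
    (hΓB : ∀ ⦃M : ℕ⦄ (k : ℕ), M ≠ 0 → k ≠ 0 → ∀ i j,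
      ZMod.castHom (Dvd.intro_left k rfl) (ZMod M)
          ((ΓB (k * M) : Matrix (Fin g ⊕ Fin g) (Fin g ⊕ Fin g) (ZMod (k * M))) i j) =
        (ΓB M : Matrix (Fin g ⊕ Fin g) (Fin g ⊕ Fin g) (ZMod M)) i j)
    (hcB : ∀ ⦃M : ℕ⦄ (k : ℕ), M ≠ 0 → k ≠ 0 →
      ZMod.castHom (Dvd.intro_left k rfl) (ZMod M) ((cB (k * M) : ZMod (k * M))) = (cB M : ZMod M))
    (hsimB : ∀ ⦃M : ℕ⦄, M ≠ 0 → ∀ x y : Fin g ⊕ Fin g → ZMod M,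
      typeFormMod δ M ((ΓB M : Matrix (Fin g ⊕ Fin g) (Fin g ⊕ Fin g) (ZMod M)) *ᵥ x)
          ((ΓB M : Matrix (Fin g ⊕ Fin g) (Fin g ⊕ Fin g) (ZMod M)) *ᵥ y) =
        (cB M : ZMod M) * typeFormMod δ M x y)
    (hsurj : ∀ (Ω : Type u) [Field Ω] [IsAlgClosed Ω] (s : Spec (.of Ω) ⟶ S),
      Function.Surjective (AlgPoints.map (L := Ω) (fibreHom u s).hom.hom.hom))
    (hK : ∀ (Ω : Type u) [Field Ω] [IsAlgClosed Ω] (s : Spec (.of Ω) ⟶ S)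
      (P : (A.fibre s).toAbelianVariety.Points Ω), AlgPoints.map (fibreHom u s).hom.hom.hom P = 1 ↔
        ∃ c : Fin g ⊕ Fin g → ZMod (N * ν),
          (γm.map (Int.castRingHom (ZMod (N * ν))) *
              ((gT⁻¹ : GL (Fin g ⊕ Fin g) (ZMod (N * ν))) : Matrix _ _ (ZMod (N * ν)))) *ᵥ c = 0 ∧
            P = A.restrictPt s (φ'.section_ c))
    (hb : u ≫ polB.lam ≫ DualPair.dualIsogenyOver u DA DB = polA.lam ^ ν)
    (h : φ'.IsSymplecticLiftable polA δ) : ψφ.IsSymplecticLiftable polB δ := by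
  haveI : NeZero (N * ν) := ⟨Nat.mul_ne_zero hN hν⟩
  haveI : NeZero N := ⟨hN⟩
  -- (1) twist the source: `φ″ := φ′·ḡ` is symplectic-liftable
  have h'' : (φ'.twist gT).IsSymplecticLiftable polA δ := by
    rw [← hΓA_level]
    exact h.twist ΓA cA hΓA hcA hsimA
  -- (2) the induced structure on the target for `φ″` is `ψφ·(ḡ mod N)`
  set gN : GL (Fin g ⊕ Fin g) (ZMod N) :=
    Matrix.GeneralLinearGroup.map (ZMod.castHom (⟨ν, rfl⟩ : N ∣ N * ν) (ZMod N)) gT with hgN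
  have hψ'' : ∀ i, (ψφ.twist gN).σ i = ((φ'.twist gT).σ i ^ ν) ≫ u := by
    intro i
    have hφσ : ∀ (χ : A.LevelStructure g (N * ν)) (k : Fin g ⊕ Fin g),
        χ.σ k ^ ν = (χ.changeLevel N ν rfl (Nat.mul_ne_zero hN hν)).σ k := fun χ k => rfl
    have hψc : ψφ.σ = fun j => (φ'.changeLevel N ν rfl (Nat.mul_ne_zero hN hν)).σ j ≫ u :=
      funext fun j => by rw [hψφ j, hφσ]
    rw [hφσ, LevelStructure.changeLevel_twist, LevelStructure.twist_σ, LevelStructure.twist_σ,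
      A.sectionPow_comp_of_isMonHom u, hψc]
  -- (3) the engine in twisted coordinates
  have hlift'' : (ψφ.twist gN).IsSymplecticLiftable polB δ :=
    LevelStructure.IsSymplecticLiftable.of_fibreIsogeny_of_dualIsogeny hN hν u hψ'' hB γm γs hγ hγ' hsim hQA4 hsurj
      (fun Ω _ _ s P => map_fibreHom_eq_one_iff_twist hN hν φ' u γm γs hγ hγ' gT s (hK Ω s) P) hb h''
  -- (4) untwist the target
  have htw : ψφ = (ψφ.twist gN).twist (ΓB N) := by
    rw [LevelStructure.twist_mul, hΓB_level, mul_inv_cancel, LevelStructure.twist_one]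
  rw [htw]
  exact hlift''.twist ΓB cB hΓB hcB hsimB

end AbelianSchemeOver

end Literature.AlgebraicGeometry.AbelianSchemes

end
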